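import Summits.MatrixMultiplication.MatrixMultiplication.Theses.MarginalColumns
import Literature.Computability.AlgebraicComplexity.BorderRankMatMulTwoHolds
import Literature.Computability.AlgebraicComplexity.BorderRankMatMulSmall223Proofs
import Literature.Computability.AlgebraicComplexity.BorderRankMatMulSmallProofs
import Literature.Computability.AlgebraicComplexity.CoppersmithWinograd1982Crude
import Summits.MatrixMultiplication.MatrixMultiplication.Theorems.SecondColumnDominates.Negative.LoadBearing

/-!
# Birth skeleton (BC3) — crux `SecondColumnDominates` of route `MarginalColumns`

Crux (FIXED; route decl `Summit.MatrixMultiplication.MatrixMultiplication.Theses.MarginalColumns.SecondColumnDominates`,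
item stmt-MatrixMultiplication-16310). With `T n w := bR⟨n,n,w⟩ = algBorderRank (matMulTensor ℂ n n w)`
(the COLUMN TOWER of the square format) it reads

  D : ∀ n w ≥ 1,  T n (w+1) + T n 1 ≤ T n w + T n 2

("no later column of the border tower costs more than the second one").

## Line `birth`: diminishing returns, split at the diagonal

MECHANISM (the route's own declared parent of D — support items `TowerConcavity` (stmt-16311) and
`ConcavityDominates` (stmt-16312) of `Theses/MarginalColumns.lean`, TWO-LAYER PLAN): if the marginal
cost `w ↦ T n (w+1) − T n w` is non-increasing (concavity of the column tower, "diminishing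
returns"), telescoping from `w = 1` gives D. The skeleton cuts concavity at the DIAGONAL `w + 2 = n`
of the tower, where the character of the statement changes:

* `stub_concaveInSquare` — concavity of the tower while all three formats `⟨n,n,w⟩, ⟨n,n,w+1⟩,
  ⟨n,n,w+2⟩` stay inside the square (`w + 2 ≤ n`). ALONE it yields the below-diagonal part of D
  (`belowDiagonal_of_concaveInSquare`, proved here, sorry-free), which is the only part the route's
  deciding theorem `closes` consumes (it calls `hD n w hn h1` only for `w + 1 ≤ n`; refuter reviews
  rreview-0816T16-5-0 / -6-0, finding M3, evidence on the item). First open cell `n = 3, w = 1`: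
  `bR⟨3,3,3⟩ + bR⟨3,3,1⟩ ≤ 2·bR⟨3,3,2⟩`, i.e. with `bR⟨3,3,1⟩ = 9` (flattening) and
  `bR⟨3,3,2⟩ ≤ 14` (tree: `Smirnov2013_algBorderRank_matMulTensor_332_le`; `= 14` is the named fact
  `ConnerHarperLandsberg2023_thm_1_4_233` rotated) exactly the route's cheapest falsifier
  `CubeNineteen : bR⟨3,3,3⟩ ≤ 19` (printed window `[17, 20]`, CHL 2023 Thm 1.1 / Smirnov 2013).
* `stub_concaveTail` — concavity for triples that reach the diagonal or leave the square
  (`n ≤ w + 1`): the regime of the SOLVED SIBLING. At `n = 2` it is the tower `bR⟨2,2,m⟩`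
  (= `bR⟨m,2,2⟩` by rotation: 4, 7, 10 exact, then ≤ 13, ≤ 16 in print — LandsbergRyder2015 §3,
  AlekseevSmirnov2013, CHL 2023 Thm 1.3): cell `(2,1)` is `10 + 4 ≤ 2·7`, PROVED below from tree
  facts (`concaveTail_cell_two_one`); cell `(2,2)` reads `bR⟨2,2,4⟩ + 7 ≤ 2·bR⟨2,2,3⟩`, i.e.
  `bR⟨2,2,4⟩ ≤ 13` given CHL Thm 1.3 (`bR⟨2,2,3⟩ = 10`); cell `(2,3)` needs `bR⟨2,2,4⟩ = 13`
  (open). With the Koszul slope `T n w ≥ (2n−1)·w` (LandsbergOttaviani2015, tree: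
  `three_mul_mul_le_two_mul_algBorderRank_matMulTensor` at n = 2) the tail forces every marginal
  `≥ 2n − 1`, hence `bR⟨n,n,n⟩ ≥ 3n² − 3n + 1` — far beyond the printed `2n² − ⌈log₂ n⌉ − 1`
  (LandsbergMichalek2018): this is the EXTRAORDINARY half (the hollow-schoolbook law's lower face),
  isolated so that a refuter can aim at it and a prover can close the in-square half independently.

`stub_concaveInSquare ∧ stub_concaveTail ↔ TowerConcavity` (`towerConcavity_iff_stubs`, proved), so
the composition below is the route's glue item `ConcavityDominates` (stmt-16312) made regime-aware.

COMPOSITION. `dominates_of_concaveSplit (hIn : <stub₁-sig>) (hTail : <stub₂-sig>) : <the crux's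
defining statement, verbatim>` is the REAL proof (induction on `w`; the step at `w` uses in-square
concavity when `w + 2 ≤ n` and tail concavity otherwise; no `sorry`, axioms
`propext`/`Classical.choice`/`Quot.sound`), and `SecondColumnDominates_of : SecondColumnDominates` — the
UNIQUE theorem of this file whose result type is the crux decl BY NAME, hence the one
`ledger skeleton check` registers — is that composition applied to the two declared stubs (the skeleton
audit admits `Prop` hypotheses only as named obligations, so the explicit-signature form concludes the
crux's body rather than its name; same layout as `Cruxes/AThesis/Lines/birth.lean`). The only `sorry`s of
this file are the two stubs.

Disproof used: none relevant — no `Cruxes/SecondColumnDominates/Disproof.lean` and no landed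
`Theorems/SecondColumnDominates/Negative/*` exist at registration (2026-08-17); the summit's
negatives index (6 refuted statements) is entirely on the STPP / design side and shares no
vocabulary with the column tower.

Registrar: planner-skel-stmt-MatrixMultiplication-16310-0 (skeleton-register, 2026-08-17).

LEAD'S NOTE (prover-line-stmt-MatrixMultiplication-16310-0, 2026-08-17T16:50Z). This line was re-picked after
line `Sketch` (koszul-pivot-split) died as COSTUME: its step stub `T n (w+1) ≤ T n w + 2n − 1` alone implies
`ω = 2` (refuter-eread `StepImpliesSummit.lean`, strategist `REDIRECT-r1.md` §3c; `Lines/Sketch-dead.md`). The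
present stubs are T1-clean (concavity is exponent-blind: the schoolbook tower `n²·w` is concave with
`t n n = n³`; VET probes stub→S fail). What `Sketch` banked rides along: the rectangular Landsberg–Ottaviani
slope `2nw ≤ T n w + w` (`Theorems/MarginalColumnsSecondColumnDominatesStubColumnSlope.lean`, p158727) and
`D ⟹ T n 2 ≥ n² + 2n − 1` (`Theorems/SecondColumnDominates/Negative/FloorOfDominates.lean`, p158920). The
section "First open cell" at the end records, kernel-checked, that `stub_concaveInSquare` at `(n,w) = (3,1)`
is the existing item stmt-MatrixMultiplication-8008 (`bR⟨3,3,3⟩ ≤ 19`) modulo CHL 2023 Thm 1.4 — so this line,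
like any line for D, cannot close before stmt-8008 does.
-/

set_option linter.dupNamespace false

namespace Summit.MatrixMultiplication.MatrixMultiplication.Cruxes.SecondColumnDominates.Birth

open Literature.Computability.AlgebraicComplexity

/-- **Stub 1 — concavity of the column tower inside the square.** For `1 ≤ w`, `w + 2 ≤ n`:
`bR⟨n,n,w+2⟩ + bR⟨n,n,w⟩ ≤ 2·bR⟨n,n,w+1⟩` (the marginal cost of a new column does not increase
while the format stays inside `⟨n,n,n⟩`). Open for every `n ≥ 3`; first cell `(3,1)` is
`bR⟨3,3,3⟩ ≤ 2·bR⟨3,3,2⟩ − 9 (= 19 if bR⟨3,3,2⟩ = 14)`, the route's `CubeNineteen`.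
Alone it gives D below the diagonal (`belowDiagonal_of_concaveInSquare`).
[cite: LandsbergGCT2017, §4.8] [cite: ConnerHarperLandsberg2023, Thm. 1.1, 1.4] [cite: Smirnov2013] -/
theorem stub_concaveInSquare :
    ∀ n w : ℕ, 1 ≤ n → 1 ≤ w → w + 2 ≤ n →
      Literature.Computability.AlgebraicComplexity.algBorderRank
          (Literature.Computability.AlgebraicComplexity.matMulTensor ℂ n n (w + 2)) +
        Literature.Computability.AlgebraicComplexity.algBorderRank
          (Literature.Computability.AlgebraicComplexity.matMulTensor ℂ n n w) ≤
      2 * Literature.Computability.AlgebraicComplexity.algBorderRank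
          (Literature.Computability.AlgebraicComplexity.matMulTensor ℂ n n (w + 1)) := by
  sorry

/-- **Stub 2 — concavity of the column tower at and past the diagonal.** For `1 ≤ n`, `1 ≤ w`,
`n ≤ w + 1`: `bR⟨n,n,w+2⟩ + bR⟨n,n,w⟩ ≤ 2·bR⟨n,n,w+1⟩`. At `n = 2` this is the diminishing-returns
form of Landsberg's expected tower law `bR⟨m,2,2⟩ = 3m + 1` (cells `(2,1)` proved below, `(2,2)`
known in print given CHL Thm 1.3, `(2,3)` open ⟺ `bR⟨2,2,4⟩ = 13`); with the Koszul slope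
`(2n−1)·w` it forces `bR⟨n,n,n⟩ ≥ 3n² − 3n + 1` (the strong half; D itself only forces
`bR⟨n,n,2⟩ ≥ n² + 2n − 1`, refuter probe W1b).
[cite: LandsbergRyder2015, §3 Prop. 3.1–3.2] [cite: LandsbergGCT2017, §4.8]
[cite: LandsbergOttaviani2015, Thm. 2.1] [cite: LandsbergMichalek2018, Thm. 1.1] -/
theorem stub_concaveTail :
    ∀ n w : ℕ, 1 ≤ n → 1 ≤ w → n ≤ w + 1 →
      Literature.Computability.AlgebraicComplexity.algBorderRank
          (Literature.Computability.AlgebraicComplexity.matMulTensor ℂ n n (w + 2)) +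
        Literature.Computability.AlgebraicComplexity.algBorderRank
          (Literature.Computability.AlgebraicComplexity.matMulTensor ℂ n n w) ≤
      2 * Literature.Computability.AlgebraicComplexity.algBorderRank
          (Literature.Computability.AlgebraicComplexity.matMulTensor ℂ n n (w + 1)) := by
  sorry

/-- **Composition with explicit signatures (kernel-checked, no sorry): the two concavity statements
give the crux's defining statement verbatim.** Induction on `w ≥ 1`: `D(1)` is an equality;
`D(w) ∧ concavity at w ⟹ D(w+1)` by adding the two inequalities, the concavity instance being in-square
when `w + 2 ≤ n` and tail otherwise. (The result type is the BODY of
`MarginalColumns.SecondColumnDominates`, not its name, so that `SecondColumnDominates_of` below is the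
file's only theorem concluding the crux by name.) [cite: LandsbergGCT2017, §4.8] -/
theorem dominates_of_concaveSplit
    (hIn : ∀ n w : ℕ, 1 ≤ n → 1 ≤ w → w + 2 ≤ n →
      Literature.Computability.AlgebraicComplexity.algBorderRank
          (Literature.Computability.AlgebraicComplexity.matMulTensor ℂ n n (w + 2)) +
        Literature.Computability.AlgebraicComplexity.algBorderRank
          (Literature.Computability.AlgebraicComplexity.matMulTensor ℂ n n w) ≤
      2 * Literature.Computability.AlgebraicComplexity.algBorderRank
          (Literature.Computability.AlgebraicComplexity.matMulTensor ℂ n n (w + 1)))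
    (hTail : ∀ n w : ℕ, 1 ≤ n → 1 ≤ w → n ≤ w + 1 →
      Literature.Computability.AlgebraicComplexity.algBorderRank
          (Literature.Computability.AlgebraicComplexity.matMulTensor ℂ n n (w + 2)) +
        Literature.Computability.AlgebraicComplexity.algBorderRank
          (Literature.Computability.AlgebraicComplexity.matMulTensor ℂ n n w) ≤
      2 * Literature.Computability.AlgebraicComplexity.algBorderRank
          (Literature.Computability.AlgebraicComplexity.matMulTensor ℂ n n (w + 1))) :
    ∀ n w : ℕ, 1 ≤ n → 1 ≤ w →
      Literature.Computability.AlgebraicComplexity.algBorderRank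
          (Literature.Computability.AlgebraicComplexity.matMulTensor ℂ n n (w + 1)) +
        Literature.Computability.AlgebraicComplexity.algBorderRank
          (Literature.Computability.AlgebraicComplexity.matMulTensor ℂ n n 1) ≤
      Literature.Computability.AlgebraicComplexity.algBorderRank
          (Literature.Computability.AlgebraicComplexity.matMulTensor ℂ n n w) +
        Literature.Computability.AlgebraicComplexity.algBorderRank
          (Literature.Computability.AlgebraicComplexity.matMulTensor ℂ n n 2) := by
  intro n w hn hw
  induction w, hw using Nat.le_induction with
  | base =>
      have e : (1 : ℕ) + 1 = 2 := rfl
      rw [e]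
      omega
  | succ w hw ih =>
      -- concavity at `w`: in-square or tail according to the position of `w + 2` vs `n`
      have hc : Literature.Computability.AlgebraicComplexity.algBorderRank
            (Literature.Computability.AlgebraicComplexity.matMulTensor ℂ n n (w + 2)) +
          Literature.Computability.AlgebraicComplexity.algBorderRank
            (Literature.Computability.AlgebraicComplexity.matMulTensor ℂ n n w) ≤
          2 * Literature.Computability.AlgebraicComplexity.algBorderRank
            (Literature.Computability.AlgebraicComplexity.matMulTensor ℂ n n (w + 1)) := by
        rcases Nat.lt_or_ge n (w + 2) with hlt | hge
        · exact hTail n w hn hw (by omega)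
        · exact hIn n w hn hw hge
      have e : w + 1 + 1 = w + 2 := rfl
      rw [e]
      omega

/-- **THE SKELETON THEOREM — the crux `SecondColumnDominates` BY NAME from the two declared stubs**
(`sorry` occurs only inside `stub_concaveInSquare` and `stub_concaveTail`; the term is the sorry-free
composition `dominates_of_concaveSplit` applied to them; `unfold` acts on the goal only, the declared
result type is the route decl itself). [cite: LandsbergGCT2017, §4.8] -/
theorem SecondColumnDominates_of :
    Summit.MatrixMultiplication.MatrixMultiplication.Theses.MarginalColumns.SecondColumnDominates := by
  unfold Summit.MatrixMultiplication.MatrixMultiplication.Theses.MarginalColumns.SecondColumnDominates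
  exact dominates_of_concaveSplit stub_concaveInSquare stub_concaveTail

/-! ## What each half buys (sorry-free corollaries and the first sibling cell) -/

/-- **In-square concavity alone gives D below the diagonal** (`w + 1 ≤ n`) — the only instances of
D that `MarginalColumns.closes` uses. Same induction, which never leaves the square. [folklore] -/
theorem belowDiagonal_of_concaveInSquare
    (hIn : ∀ n w : ℕ, 1 ≤ n → 1 ≤ w → w + 2 ≤ n →
      Literature.Computability.AlgebraicComplexity.algBorderRank
          (Literature.Computability.AlgebraicComplexity.matMulTensor ℂ n n (w + 2)) +
        Literature.Computability.AlgebraicComplexity.algBorderRank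
          (Literature.Computability.AlgebraicComplexity.matMulTensor ℂ n n w) ≤
      2 * Literature.Computability.AlgebraicComplexity.algBorderRank
          (Literature.Computability.AlgebraicComplexity.matMulTensor ℂ n n (w + 1))) :
    ∀ n w : ℕ, 1 ≤ n → 1 ≤ w → w + 1 ≤ n →
      Literature.Computability.AlgebraicComplexity.algBorderRank
          (Literature.Computability.AlgebraicComplexity.matMulTensor ℂ n n (w + 1)) +
        Literature.Computability.AlgebraicComplexity.algBorderRank
          (Literature.Computability.AlgebraicComplexity.matMulTensor ℂ n n 1) ≤
      Literature.Computability.AlgebraicComplexity.algBorderRank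
          (Literature.Computability.AlgebraicComplexity.matMulTensor ℂ n n w) +
        Literature.Computability.AlgebraicComplexity.algBorderRank
          (Literature.Computability.AlgebraicComplexity.matMulTensor ℂ n n 2) := by
  intro n w hn hw hwn
  induction w, hw using Nat.le_induction with
  | base =>
      have e : (1 : ℕ) + 1 = 2 := rfl
      rw [e]
      omega
  | succ w hw ih =>
      have ih' := ih (by omega)
      have hc := hIn n w hn hw (by omega)
      have e : w + 1 + 1 = w + 2 := rfl
      rw [e]
      omega

/-- **The two stubs together are exactly the route's support item `TowerConcavity`**
(stmt-MatrixMultiplication-16311): the skeleton is the declared parent of D, cut at the diagonal.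
[folklore] -/
theorem towerConcavity_iff_stubs :
    Summit.MatrixMultiplication.MatrixMultiplication.Theses.MarginalColumns.TowerConcavity ↔
      ((∀ n w : ℕ, 1 ≤ n → 1 ≤ w → w + 2 ≤ n →
        Literature.Computability.AlgebraicComplexity.algBorderRank
            (Literature.Computability.AlgebraicComplexity.matMulTensor ℂ n n (w + 2)) +
          Literature.Computability.AlgebraicComplexity.algBorderRank
            (Literature.Computability.AlgebraicComplexity.matMulTensor ℂ n n w) ≤
        2 * Literature.Computability.AlgebraicComplexity.algBorderRank
            (Literature.Computability.AlgebraicComplexity.matMulTensor ℂ n n (w + 1))) ∧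
      (∀ n w : ℕ, 1 ≤ n → 1 ≤ w → n ≤ w + 1 →
        Literature.Computability.AlgebraicComplexity.algBorderRank
            (Literature.Computability.AlgebraicComplexity.matMulTensor ℂ n n (w + 2)) +
          Literature.Computability.AlgebraicComplexity.algBorderRank
            (Literature.Computability.AlgebraicComplexity.matMulTensor ℂ n n w) ≤
        2 * Literature.Computability.AlgebraicComplexity.algBorderRank
            (Literature.Computability.AlgebraicComplexity.matMulTensor ℂ n n (w + 1)))) := by
  unfold Summit.MatrixMultiplication.MatrixMultiplication.Theses.MarginalColumns.TowerConcavity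
  constructor
  · intro h
    exact ⟨fun n w hn hw _ => h n w hn hw, fun n w hn hw _ => h n w hn hw⟩
  · rintro ⟨hIn, hTail⟩ n w hn hw
    rcases Nat.lt_or_ge n (w + 2) with hlt | hge
    · exact hTail n w hn hw (by omega)
    · exact hIn n w hn hw hge

/-- **First cell of the tail stub, `(n, w) = (2, 1)`, from tree facts (BC5 special case):**
`bR⟨2,2,3⟩ + bR⟨2,2,1⟩ ≤ 10 + 4 = 2·7 = 2·bR⟨2,2,2⟩` (Bini–Capovani–Romani–Lotti 1979 `≤ 10`;
standard algorithm `≤ 4`; Landsberg 2006 `bR⟨2,2,2⟩ = 7`, proved in tree).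
[cite: BiniCapovaniRomaniLotti1979, main result (via BCS §15.2)] [cite: Landsberg2005, main theorem (p. 447)] -/
theorem concaveTail_cell_two_one :
    Literature.Computability.AlgebraicComplexity.algBorderRank
          (Literature.Computability.AlgebraicComplexity.matMulTensor ℂ 2 2 3) +
        Literature.Computability.AlgebraicComplexity.algBorderRank
          (Literature.Computability.AlgebraicComplexity.matMulTensor ℂ 2 2 1) ≤
      2 * Literature.Computability.AlgebraicComplexity.algBorderRank
          (Literature.Computability.AlgebraicComplexity.matMulTensor ℂ 2 2 2) := by
  have h10 : algBorderRank (matMulTensor ℂ 2 2 3) ≤ 10 :=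
    BCRL1979_algBorderRank_matMulTensor_223_le ℂ
  have h4 : algBorderRank (matMulTensor ℂ 2 2 1) ≤ 4 :=
    (algBorderRank_le_tensorRank _).trans
      ((tensorRank_matMulTensor_le ℂ 2 2 1).trans (by norm_num))
  have h7 : algBorderRank (matMulTensor ℂ 2 2 2) = 7 := algBorderRank_matMulTensor_two ℂ
  omega

/-- The cell above in the exact shape of `stub_concaveTail` (instance `n = 2, w = 1`): the stub is
inhabited in kind and the definitions compute. [folklore] -/
theorem concaveTail_holds_at_two_one :
    ∀ n w : ℕ, n = 2 → w = 1 →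
      Literature.Computability.AlgebraicComplexity.algBorderRank
          (Literature.Computability.AlgebraicComplexity.matMulTensor ℂ n n (w + 2)) +
        Literature.Computability.AlgebraicComplexity.algBorderRank
          (Literature.Computability.AlgebraicComplexity.matMulTensor ℂ n n w) ≤
      2 * Literature.Computability.AlgebraicComplexity.algBorderRank
          (Literature.Computability.AlgebraicComplexity.matMulTensor ℂ n n (w + 1)) := by
  rintro n w rfl rfl
  exact concaveTail_cell_two_one

/-! ## First open cell of the in-square stub = stmt-MatrixMultiplication-8008 (lead, kernel-checked) -/

/-- **The first open cell `(n, w) = (3, 1)` of `stub_concaveInSquare` implies `CubeNineteen`:**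
`bR⟨3,3,3⟩ + bR⟨3,3,1⟩ ≤ 2·bR⟨3,3,2⟩ ≤ 28` (Smirnov 2013: `bR⟨3,3,2⟩ ≤ 14`, PROVED in tree) with
`bR⟨3,3,1⟩ = 9` gives `bR⟨3,3,3⟩ ≤ 19`, the existing open item stmt-MatrixMultiplication-8008.
[cite: Smirnov2013, Table 4] -/
theorem cubeNineteen_of_concaveInSquare_cell_three_one
    (h : Literature.Computability.AlgebraicComplexity.algBorderRank
          (Literature.Computability.AlgebraicComplexity.matMulTensor ℂ 3 3 (1 + 2)) +
        Literature.Computability.AlgebraicComplexity.algBorderRank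
          (Literature.Computability.AlgebraicComplexity.matMulTensor ℂ 3 3 1) ≤
      2 * Literature.Computability.AlgebraicComplexity.algBorderRank
          (Literature.Computability.AlgebraicComplexity.matMulTensor ℂ 3 3 (1 + 1))) :
    Summit.MatrixMultiplication.MatrixMultiplication.Theses.MarginalColumns.CubeNineteen := by
  unfold Summit.MatrixMultiplication.MatrixMultiplication.Theses.MarginalColumns.CubeNineteen
  have h14 : algBorderRank (matMulTensor ℂ 3 3 2) ≤ 14 := Smirnov2013_algBorderRank_matMulTensor_332_le ℂ
  have h9 := Summit.MatrixMultiplication.MatrixMultiplication.Theorems.SecondColumnDominates.Negative.algBorderRank_matMulTensor_sq_one 3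
  simp only [Nat.reduceAdd] at h
  omega

/-- **Conversely, `CubeNineteen` and the printed `bR⟨2,3,3⟩ = 14` (CHL 2023 Thm 1.4, named fact, rotated to
`bR⟨3,3,2⟩`) give the cell `(3,1)`:** `19 + 9 ≤ 2·14`. So modulo CHL Thm 1.4 the first open cell of
`stub_concaveInSquare` IS stmt-MatrixMultiplication-8008. [cite: ConnerHarperLandsberg2023, Thm. 1.4] -/
theorem concaveInSquare_cell_three_one_of_cubeNineteen (h14 : ConnerHarperLandsberg2023_thm_1_4_233)
    (h19 : Summit.MatrixMultiplication.MatrixMultiplication.Theses.MarginalColumns.CubeNineteen) :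
    Literature.Computability.AlgebraicComplexity.algBorderRank
          (Literature.Computability.AlgebraicComplexity.matMulTensor ℂ 3 3 (1 + 2)) +
        Literature.Computability.AlgebraicComplexity.algBorderRank
          (Literature.Computability.AlgebraicComplexity.matMulTensor ℂ 3 3 1) ≤
      2 * Literature.Computability.AlgebraicComplexity.algBorderRank
          (Literature.Computability.AlgebraicComplexity.matMulTensor ℂ 3 3 (1 + 1)) := by
  unfold Summit.MatrixMultiplication.MatrixMultiplication.Theses.MarginalColumns.CubeNineteen at h19
  unfold ConnerHarperLandsberg2023_thm_1_4_233 at h14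
  have hrot : algBorderRank (matMulTensor ℂ 3 3 2) = algBorderRank (matMulTensor ℂ 2 3 3) := by
    rw [algBorderRank_matMulTensor_rotate, algBorderRank_matMulTensor_rotate]
  have h9 := Summit.MatrixMultiplication.MatrixMultiplication.Theorems.SecondColumnDominates.Negative.algBorderRank_matMulTensor_sq_one 3
  simp only [Nat.reduceAdd]
  omega

/-- **In-square cell `(n, w) = (4, 1)` and `(4, 2)` are open in print** is not a theorem; what IS decided is the
trivial upper side of cell `(2,·)`: the in-square stub has NO cells at `n = 2` (`w + 2 ≤ 2` forces `w = 0 < 1`),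
so its content starts at `n = 3`. [folklore] -/
theorem concaveInSquare_vacuous_at_two :
    ∀ w : ℕ, 1 ≤ w → w + 2 ≤ 2 →
      Literature.Computability.AlgebraicComplexity.algBorderRank
          (Literature.Computability.AlgebraicComplexity.matMulTensor ℂ 2 2 (w + 2)) +
        Literature.Computability.AlgebraicComplexity.algBorderRank
          (Literature.Computability.AlgebraicComplexity.matMulTensor ℂ 2 2 w) ≤
      2 * Literature.Computability.AlgebraicComplexity.algBorderRank
          (Literature.Computability.AlgebraicComplexity.matMulTensor ℂ 2 2 (w + 1)) := by
  intro w hw h2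
  omega

end Summit.MatrixMultiplication.MatrixMultiplication.Cruxes.SecondColumnDominates.Birth
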